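import Summits.AtomisticToContinuum.Crystallization.Theorems.ChartedPlanarOrderTubeMonotoneSplit
import Summits.AtomisticToContinuum.Crystallization.Theorems.ChartedPlanarOrderCleanStackedIndependent
import Summits.AtomisticToContinuum.Crystallization.Theorems.ChartedPlanarOrderPlanesPairs

/-!
# Slot 7b by the method of planes, module P3c: range truncation of the gap stress — the `1/R` law (decomp-a2c lens-3 g26; critic rows 519 (1) R1, 523 (b) (g1))

Blocker `N = ChartedPlanarOrder.ChartedZeroExcessLayered`, leaf 7b `GapStressVanishesW (17/16)`.  For a stacked layered configuration
`Y = Layered a b w` (`δ`-separated, independent periods, heights `⟪ν, w (j+1) − w j⟫ ∈ [h_lo, h_hi]` along the unit normal `ν ⊥ a, b`) and a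
RANGE `R > 0`, the TRUNCATED PAIR SUM of the layer pair `(k, l)` is the finite sum

  `Φ_R(k,l) = PhiR a b w R k l = Σ_{μ ∈ ℤ² : ‖w k − layerPoint (l, μ)‖ ≤ R} pairForce (w k − layerPoint a b w (l, μ))`

(§1; the index set `nearSet` is finite by separation, `…CleanStackedIndependent.finite_sep_inter_closedBall`).  §2: ODDNESS `Φ_R(l,k) = −Φ_R(k,l)`
(the reflection `μ ↦ −μ` and Newton III — this is what the symmetric Euclidean truncation buys, memo PLAN-7b / bus l.2629), VANISHING
`Φ_R(k,l) = 0` once `h_lo |l − k| > R`, the uniform bound `‖Φ_R(k,l)‖ ≤ 64 K(δ) (δ/2h_lo)³`, and the translation identity behind the column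
rearrangement of P3d.  §3 ★ THE TRUNCATION LAW (guard (g1): closed-form constant, uniform in the gap `m` and in the configuration):

  `‖gapStress a b m (incr w) − Σ_{K₀ ≤ k < m ≤ l ≤ K₁} Φ_R(k,l)‖ ≤ 64 K(δ) (δ/2h_lo)³ (2 h_hi + δ) / R`

for every window with `h_lo (m − K₀) ≥ R`, `h_lo (K₁ + 1 − m) ≥ R` (`norm_gapStress_sub_sum_PhiR_le`): the gap stress is the (absolutely convergent,
`…PlanesPairs.sum_norm_gapFam_le_total`) series of the pair-point family; its terms within range are exactly the window sum of the `Φ_R`, and the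
terms beyond range have total norm `≤ C₂/R` by `…PlanesPairs.sum_norm_gapFam_le_tail`.

Mathlib only (+ the lens-3 modules imported); `[folklore]`; no instances, no notation, sorry-free.
-/

noncomputable section

open MeasureTheory Set Metric Filter Topology
open scoped RealInnerProductSpace
open Summit.AtomisticToContinuum.Crystallization.Theorems.ChartedPlanarOrderRigidityDoor
open Summit.AtomisticToContinuum.Crystallization.Theorems.ChartedPlanarOrderDensityDichotomy
open Summit.AtomisticToContinuum.Crystallization.Theorems.ChartedPlanarOrderMesoCut
open Summit.AtomisticToContinuum.Crystallization.Theorems.ChartedPlanarOrderProfileSlavingLJ (pairForce layerForce IsStacked Straddle gapStress incr)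
open Summit.AtomisticToContinuum.Crystallization.Theorems.ChartedPlanarOrderProfileSlavingLJBalance (pairForce_neg)
open Summit.AtomisticToContinuum.Crystallization.Theorems.ChartedPlanarOrderDoorLayered (Layered)
open Summit.AtomisticToContinuum.Crystallization.Theorems.ChartedPlanarOrderNashForceBalance
open Summit.AtomisticToContinuum.Crystallization.Theorems.ChartedPlanarOrderSepCounting (gridE)
open Summit.AtomisticToContinuum.Crystallization.Theorems.ChartedPlanarOrderStraddleSummable (inner_layerPoint)
open Summit.AtomisticToContinuum.Crystallization.Theorems.ChartedPlanarOrderCleanStackedIndependent (finite_sep_inter_closedBall)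
open Summit.AtomisticToContinuum.Crystallization.Theorems.ChartedPlanarOrderTubeMonotoneSplit (gapStress_eq_tsum famOf_incr)
open Summit.AtomisticToContinuum.Crystallization.Theorems.ChartedPlanarOrderPlanesPairs

namespace Summit.AtomisticToContinuum.Crystallization.Theorems.ChartedPlanarOrderPlanesTail

variable {δ : ℝ} {a b ν : E3} {w : ℤ → E3} {h_lo h_hi : ℝ}

/-! ## 1. The truncated pair sums `Φ_R(k,l)` -/

section Truncated

/-- the planar indices of the atoms of layer `l` within range `R` of `w k`. -/
def nearSet (a b : E3) (w : ℤ → E3) (R : ℝ) (k l : ℤ) : Set (ℤ × ℤ) := {μ | ‖w k - layerPoint a b w (l, μ)‖ ≤ R}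

/-- the range set is finite (separation: finitely many atoms in a ball; the layer parametrisation is injective). -/
theorem nearSet_finite (hδ : 0 < δ) (hS : IsSep δ (Layered a b w)) (hab : LinearIndependent ℝ ![a, b]) (hst : IsStacked a b w)
    (R : ℝ) (k l : ℤ) : (nearSet a b w R k l).Finite := by
  refine Set.Finite.of_injOn (f := fun μ : ℤ × ℤ => layerPoint a b w (l, μ)) (t := Layered a b w ∩ closedBall (w k) R)
    (fun μ hμ => ⟨layerPoint_mem _, ?_⟩) (fun μ _ μ' _ h => ?_) (finite_sep_inter_closedBall hδ hS (w k) R)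
  · rw [mem_closedBall, dist_eq_norm, norm_sub_rev]; exact hμ
  · have h2 := layerPoint_injective hab hst h
    exact (Prod.mk.inj h2).2

/-- the range set as a finset (`∅` as junk if it were infinite). -/
def near (a b : E3) (w : ℤ → E3) (R : ℝ) (k l : ℤ) : Finset (ℤ × ℤ) := by
  classical exact if h : (nearSet a b w R k l).Finite then h.toFinset else ∅

/-- membership in the range finset. -/
theorem mem_near {R : ℝ} {k l : ℤ} (hfin : (nearSet a b w R k l).Finite) {μ : ℤ × ℤ} :
    μ ∈ near a b w R k l ↔ ‖w k - layerPoint a b w (l, μ)‖ ≤ R := by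
  rw [near, dif_pos hfin, Set.Finite.mem_toFinset]; rfl

/-- ★ the TRUNCATED PAIR SUM `Φ_R(k,l)`: the force on `w k` from the atoms of layer `l` within range `R`. -/
def PhiR (a b : E3) (w : ℤ → E3) (R : ℝ) (k l : ℤ) : E3 :=
  ∑ μ ∈ near a b w R k l, pairForce (w k - layerPoint a b w (l, μ))

end Truncated

/-! ## 2. Oddness, vanishing beyond the range, the uniform bound, translation -/

section Properties

/-- reflecting the planar index swaps the roles of the two layers. -/
theorem sub_layerPoint_swap (a b : E3) (w : ℤ → E3) (k l : ℤ) (μ : ℤ × ℤ) :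
    w l - layerPoint a b w (k, μ) = -(w k - layerPoint a b w (l, -μ)) := by
  simp only [layerPoint, Prod.fst_neg, Prod.snd_neg, Int.cast_neg, neg_smul]
  abel

/-- translation along the layer lattice: differences of atoms of layers `k`, `l` are differences `w k − layerPoint (l, ·)`. -/
theorem layerPoint_sub_layerPoint (a b : E3) (w : ℤ → E3) (k l : ℤ) (μ μ' : ℤ × ℤ) :
    layerPoint a b w (k, μ) - layerPoint a b w (l, μ') = w k - layerPoint a b w (l, μ' - μ) := by
  simp only [layerPoint, Prod.fst_sub, Prod.snd_sub, Int.cast_sub, sub_smul]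
  abel

/-- the range finsets of `(l, k)` and `(k, l)` correspond under `μ ↦ −μ`. -/
theorem near_swap (hδ : 0 < δ) (hS : IsSep δ (Layered a b w)) (hab : LinearIndependent ℝ ![a, b]) (hst : IsStacked a b w)
    (R : ℝ) (k l : ℤ) : near a b w R l k = (near a b w R k l).image fun μ => -μ := by
  classical
  ext μ
  rw [mem_near (nearSet_finite hδ hS hab hst R l k), Finset.mem_image]
  constructor
  · intro h
    refine ⟨-μ, ?_, neg_neg μ⟩
    rw [mem_near (nearSet_finite hδ hS hab hst R k l)]
    rw [sub_layerPoint_swap, norm_neg] at h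
    exact h
  · rintro ⟨μ', hμ', rfl⟩
    rw [mem_near (nearSet_finite hδ hS hab hst R k l)] at hμ'
    rw [sub_layerPoint_swap, norm_neg, neg_neg]
    exact hμ'

/-- ★ ODDNESS (Newton III under the symmetric truncation): `Φ_R(l,k) = −Φ_R(k,l)`. -/
theorem PhiR_swap (hδ : 0 < δ) (hS : IsSep δ (Layered a b w)) (hab : LinearIndependent ℝ ![a, b]) (hst : IsStacked a b w)
    (R : ℝ) (k l : ℤ) : PhiR a b w R l k = -PhiR a b w R k l := by
  classical
  unfold PhiR
  rw [near_swap hδ hS hab hst R k l, Finset.sum_image fun μ _ μ' _ h => neg_injective h, ← Finset.sum_neg_distrib]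
  refine Finset.sum_congr rfl fun μ _ => ?_
  rw [sub_layerPoint_swap, neg_neg, pairForce_neg]

/-- layers `k`, `l` are `≥ h_lo |l − k|` apart, hence so are their atoms. -/
theorem norm_sub_layerPoint_ge (hν : ‖ν‖ = 1) (hνa : ⟪ν, a⟫ = 0) (hνb : ⟪ν, b⟫ = 0)
    (hH : ∀ j : ℤ, h_lo ≤ ⟪ν, w (j + 1) - w j⟫ ∧ ⟪ν, w (j + 1) - w j⟫ ≤ h_hi) (k l : ℤ) (μ : ℤ × ℤ) :
    h_lo * |((l - k : ℤ) : ℝ)| ≤ ‖w k - layerPoint a b w (l, μ)‖ := by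
  have h1 : |⟪ν, w k - layerPoint a b w (l, μ)⟫| ≤ ‖w k - layerPoint a b w (l, μ)‖ := by
    have := abs_real_inner_le_norm ν (w k - layerPoint a b w (l, μ))
    rw [hν, one_mul] at this
    exact this
  rw [inner_sub_right, inner_layerPoint hνa hνb] at h1
  refine le_trans ?_ h1
  rcases le_or_gt k l with hkl | hlk
  · have h2 := (heights_of_le hH hkl).1
    have h3 : |((l - k : ℤ) : ℝ)| = ((l - k : ℤ) : ℝ) := abs_of_nonneg (by exact_mod_cast sub_nonneg.mpr hkl)
    rw [h3, abs_sub_comm]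
    exact h2.trans (le_abs_self _)
  · have h2 := (heights_of_le hH hlk.le).1
    have h3 : |((l - k : ℤ) : ℝ)| = ((k - l : ℤ) : ℝ) := by
      rw [abs_of_neg (by exact_mod_cast (show (l - k : ℤ) < 0 by omega))]
      push_cast
      ring
    rw [h3]
    exact h2.trans (le_abs_self _)

/-- ★ VANISHING beyond the range: `Φ_R(k,l) = 0` once `h_lo |l − k| > R`. -/
theorem PhiR_eq_zero_of_far (hν : ‖ν‖ = 1) (hνa : ⟪ν, a⟫ = 0) (hνb : ⟪ν, b⟫ = 0)
    (hH : ∀ j : ℤ, h_lo ≤ ⟪ν, w (j + 1) - w j⟫ ∧ ⟪ν, w (j + 1) - w j⟫ ≤ h_hi) {R : ℝ} {k l : ℤ}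
    (hR : R < h_lo * |((l - k : ℤ) : ℝ)|) : PhiR a b w R k l = 0 := by
  have hempty : ∀ μ : ℤ × ℤ, μ ∉ nearSet a b w R k l := fun μ hμ =>
    absurd (lt_of_le_of_lt hμ hR) (not_lt.mpr (norm_sub_layerPoint_ge hν hνa hνb hH k l μ))
  have hfin : (nearSet a b w R k l).Finite := by
    rw [show nearSet a b w R k l = ∅ from Set.subset_empty_iff.mp fun μ hμ => (hempty μ hμ).elim]
    exact Set.finite_empty
  have hnear : near a b w R k l = ∅ :=
    Finset.subset_empty.mp fun μ hμ => (hempty μ ((mem_near hfin).mp hμ)).elim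
  unfold PhiR
  rw [hnear, Finset.sum_empty]

/-- the pair forces from the atoms of a HIGHER layer `l > k` on `w k`, summed over any finite set of them, are `≤ 64 K(δ) (δ/2h_lo)³` in total norm
(`…PlanesPairs.sum_norm_gapFam_le_total` on gap `l`). -/
theorem sum_norm_pairForce_le (hδ : 0 < δ) (hS : IsSep δ (Layered a b w)) (hab : LinearIndependent ℝ ![a, b])
    (hνa : ⟪ν, a⟫ = 0) (hνb : ⟪ν, b⟫ = 0) (hlo : 0 < h_lo)
    (hH : ∀ j : ℤ, h_lo ≤ ⟪ν, w (j + 1) - w j⟫ ∧ ⟪ν, w (j + 1) - w j⟫ ≤ h_hi)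
    (e : OrthonormalBasis (Fin 3) ℝ E3) (he : e 0 = ν) {k l : ℤ} (hkl : k < l) (U : Finset (ℤ × ℤ)) :
    ∑ μ ∈ U, ‖pairForce (w k - layerPoint a b w (l, μ))‖ ≤ 64 * Kc δ * (δ / (2 * h_lo)) ^ 3 := by
  let emb : (ℤ × ℤ) ↪ Straddle l × (ℤ × ℤ) :=
    ⟨fun μ => (⟨(k, l), hkl, le_rfl⟩, μ), fun μ μ' h => (Prod.mk.inj h).2⟩
  have h := sum_norm_gapFam_le_total hδ hS hab hνa hνb hlo hH e he l (U.map emb)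
  rw [Finset.sum_map] at h
  exact h

/-- ★ the uniform bound `‖Φ_R(k,l)‖ ≤ 64 K(δ) (δ/2h_lo)³` for `k ≠ l`. -/
theorem norm_PhiR_le (hδ : 0 < δ) (hS : IsSep δ (Layered a b w)) (hab : LinearIndependent ℝ ![a, b])
    (hνa : ⟪ν, a⟫ = 0) (hνb : ⟪ν, b⟫ = 0) (hlo : 0 < h_lo)
    (hH : ∀ j : ℤ, h_lo ≤ ⟪ν, w (j + 1) - w j⟫ ∧ ⟪ν, w (j + 1) - w j⟫ ≤ h_hi)
    (e : OrthonormalBasis (Fin 3) ℝ E3) (he : e 0 = ν) (R : ℝ) {k l : ℤ} (hkl : k ≠ l) :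
    ‖PhiR a b w R k l‖ ≤ 64 * Kc δ * (δ / (2 * h_lo)) ^ 3 := by
  have hst : IsStacked a b w := isStacked_of_heights hνa hνb hlo hH
  rcases lt_or_gt_of_ne hkl with h | h
  · exact (norm_sum_le _ _).trans (sum_norm_pairForce_le hδ hS hab hνa hνb hlo hH e he h _)
  · rw [PhiR_swap hδ hS hab hst R l k, norm_neg]
    exact (norm_sum_le _ _).trans (sum_norm_pairForce_le hδ hS hab hνa hνb hlo hH e he h _)

end Properties

/-! ## 3. ★ The truncation law of the gap stress -/

section Law

/-- ★★ THE `1/R` TRUNCATION LAW: across every gap `m`, the gap stress differs from the window sum of the truncated pair sums by at most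
`64 K(δ) (δ/2h_lo)³ (2 h_hi + δ) / R`, for every window `[K₀, K₁]` with `h_lo (m − K₀) ≥ R` and `h_lo (K₁ + 1 − m) ≥ R` — uniformly in `m`
and in the configuration. -/
theorem norm_gapStress_sub_sum_PhiR_le (hδ : 0 < δ) (hS : IsSep δ (Layered a b w)) (hab : LinearIndependent ℝ ![a, b])
    (hν : ‖ν‖ = 1) (hνa : ⟪ν, a⟫ = 0) (hνb : ⟪ν, b⟫ = 0) (hlo : 0 < h_lo) (hhi : 0 < h_hi)
    (hH : ∀ j : ℤ, h_lo ≤ ⟪ν, w (j + 1) - w j⟫ ∧ ⟪ν, w (j + 1) - w j⟫ ≤ h_hi)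
    (e : OrthonormalBasis (Fin 3) ℝ E3) (he : e 0 = ν) {R : ℝ} (hR : 0 < R) {K₀ K₁ m : ℤ}
    (hK₀ : R ≤ h_lo * ((m - K₀ : ℤ) : ℝ)) (hK₁ : R ≤ h_lo * ((K₁ + 1 - m : ℤ) : ℝ)) :
    ‖gapStress a b m (incr w) - ∑ k ∈ Finset.Ico K₀ m, ∑ l ∈ Finset.Icc m K₁, PhiR a b w R k l‖ ≤
      64 * Kc δ * (δ / (2 * h_lo)) ^ 3 * (2 * h_hi + δ) / R := by
  classical
  have hst : IsStacked a b w := isStacked_of_heights hνa hνb hlo hH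
  -- summability of the pair-point family from the total master bound
  have hsn : Summable fun q : Straddle m × (ℤ × ℤ) => ‖gapFam a b w m q‖ :=
    summable_of_sum_le (fun q => norm_nonneg _) fun T => sum_norm_gapFam_le_total hδ hS hab hνa hνb hlo hH e he m T
  have hs : Summable (gapFam a b w m) := hsn.of_norm
  -- the gap stress is its series
  have hσ : gapStress a b m (incr w) = ∑' q, gapFam a b w m q := by
    rw [gapStress_eq_tsum, famOf_incr, hs.tsum_prod]
    exact tsum_congr fun p => layerForce_eq_tsum_layerPoint a b w p.1.1 p.1.2
  -- the window, the near index finset and its image in the index type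
  set W : Finset (ℤ × ℤ) := Finset.Ico K₀ m ×ˢ Finset.Icc m K₁ with hW
  set B : Finset (ℤ × ℤ) := W.biUnion fun p => near a b w R p.1 p.2 with hB
  set r : Finset ((ℤ × ℤ) × (ℤ × ℤ)) := (W ×ˢ B).filter fun x => x.2 ∈ near a b w R x.1.1 x.1.2 with hr
  have hmr : ∀ x : (ℤ × ℤ) × (ℤ × ℤ), x ∈ r ↔ x.1 ∈ W ∧ x.2 ∈ near a b w R x.1.1 x.1.2 := by
    intro x
    rw [hr, Finset.mem_filter, Finset.mem_product]
    constructor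
    · rintro ⟨⟨h1, -⟩, h2⟩; exact ⟨h1, h2⟩
    · rintro ⟨h1, h2⟩; exact ⟨⟨h1, by rw [hB]; exact Finset.mem_biUnion.mpr ⟨x.1, h1, h2⟩⟩, h2⟩
  have hPW : ∀ x ∈ r, x.1.1 < m ∧ m ≤ x.1.2 := fun x hx => by
    have h1 := ((hmr x).mp hx).1
    rw [hW, Finset.mem_product, Finset.mem_Ico, Finset.mem_Icc] at h1
    exact ⟨h1.1.2, h1.2.1⟩
  let embS : {x // x ∈ r} ↪ Straddle m × (ℤ × ℤ) :=
    ⟨fun x => (⟨x.1.1, hPW x.1 x.2⟩, x.1.2), fun x y hxy => by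
      apply Subtype.ext
      have h1 := congrArg (fun q : Straddle m × (ℤ × ℤ) => (q.1.1, q.2)) hxy
      simpa using h1⟩
  set N : Finset (Straddle m × (ℤ × ℤ)) := r.attach.map embS with hN
  -- the finite near part is the window sum of the truncated pair sums
  have hNsum : ∑ q ∈ N, gapFam a b w m q = ∑ k ∈ Finset.Ico K₀ m, ∑ l ∈ Finset.Icc m K₁, PhiR a b w R k l := by
    let F : (ℤ × ℤ) × (ℤ × ℤ) → E3 := fun y => pairForce (w y.1.1 - layerPoint a b w (y.1.2, y.2))
    calc ∑ q ∈ N, gapFam a b w m q = ∑ x ∈ r.attach, gapFam a b w m (embS x) := by rw [hN, Finset.sum_map]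
      _ = ∑ x ∈ r.attach, F ↑x := rfl
      _ = ∑ x ∈ r, F x := Finset.sum_attach r F
      _ = ∑ p ∈ W, ∑ μ ∈ near a b w R p.1 p.2, F (p, μ) := Finset.sum_finset_product r W (fun p => near a b w R p.1 p.2) hmr
      _ = ∑ k ∈ Finset.Ico K₀ m, ∑ l ∈ Finset.Icc m K₁, PhiR a b w R k l := by rw [hW, Finset.sum_product]; rfl
  -- every index outside `N` is beyond the range
  have hfar : ∀ q : Straddle m × (ℤ × ℤ), q ∉ N → R < ‖w q.1.1.1 - layerPoint a b w (q.1.1.2, q.2)‖ := by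
    intro q hq
    by_contra hle
    rw [not_lt] at hle
    apply hq
    have hkm : q.1.1.1 < m := q.1.2.1
    have hml : m ≤ q.1.1.2 := q.1.2.2
    have hge := norm_sub_layerPoint_ge (a := a) (b := b) (w := w) hν hνa hνb hH q.1.1.1 q.1.1.2 q.2
    have hlk : (0 : ℝ) ≤ ((q.1.1.2 - q.1.1.1 : ℤ) : ℝ) := by exact_mod_cast (show (0 : ℤ) ≤ q.1.1.2 - q.1.1.1 by omega)
    rw [abs_of_nonneg hlk] at hge
    have h1 : ((q.1.1.2 - q.1.1.1 : ℤ) : ℝ) ≤ ((m - K₀ : ℤ) : ℝ) := le_of_mul_le_mul_left (by linarith) hlo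
    have h2 : ((q.1.1.2 - q.1.1.1 : ℤ) : ℝ) ≤ ((K₁ + 1 - m : ℤ) : ℝ) := le_of_mul_le_mul_left (by linarith) hlo
    have h1' : q.1.1.2 - q.1.1.1 ≤ m - K₀ := by exact_mod_cast h1
    have h2' : q.1.1.2 - q.1.1.1 ≤ K₁ + 1 - m := by exact_mod_cast h2
    have hW1 : q.1.1 ∈ W := by
      rw [hW, Finset.mem_product, Finset.mem_Ico, Finset.mem_Icc]
      omega
    have hμ : q.2 ∈ near a b w R q.1.1.1 q.1.1.2 := (mem_near (nearSet_finite hδ hS hab hst R _ _)).mpr hle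
    have hx : (q.1.1, q.2) ∈ r := (hmr _).mpr ⟨hW1, hμ⟩
    rw [hN]
    exact Finset.mem_map.mpr ⟨⟨(q.1.1, q.2), hx⟩, Finset.mem_attach _ _, rfl⟩
  -- assembly: the difference is the series over the complement of `N`
  have hsplit := hs.sum_add_tsum_subtype_compl N
  have hdiff : gapStress a b m (incr w) - ∑ k ∈ Finset.Ico K₀ m, ∑ l ∈ Finset.Icc m K₁, PhiR a b w R k l =
      ∑' q : {q : Straddle m × (ℤ × ℤ) // q ∉ N}, gapFam a b w m q := by
    rw [hσ, ← hNsum, ← hsplit]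
    abel
  rw [hdiff]
  have hsn' : Summable fun q : {q : Straddle m × (ℤ × ℤ) // q ∉ N} => ‖gapFam a b w m q‖ := hsn.subtype _
  refine (norm_tsum_le_tsum_norm hsn').trans (Real.tsum_le_of_sum_le (fun q => norm_nonneg _) fun u => ?_)
  have h := sum_norm_gapFam_le_tail hδ hS hab hνa hνb hlo hhi hH e he m (u.map (Function.Embedding.subtype _)) hR
    (fun q hq => by
      obtain ⟨x, _, rfl⟩ := Finset.mem_map.mp hq
      exact hfar x x.2)
  rw [Finset.sum_map] at h
  exact h

end Law

end Summit.AtomisticToContinuum.Crystallization.Theorems.ChartedPlanarOrderPlanesTail
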